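import Summits.SmoothPoincare4.SmoothPoincare4.Theorems.DottedCircleRasmussenDcrGapHelperHandlebodyChartModelHandlesCollarPhase

/-!
# Helper `helper_handlebodyChart_modelHandles` (M3: handle structure of the model dotted handlebody `D_k`)
# of line `mk_friends` for crux `DcrGap` — swept angles of equivariant flows
(item stmt-SmoothPoincare4-16128, route route-SmoothPoincare4-DottedCircleRasmussen)

**Registered piece `helper_handlebodyChart_modelHandles_flowPhase` of the model lemma M3.**  The last two
stages of the squeeze of part 2 of the data stub `helper_handlebodyChart_modelHandles_data` (inflation of
the holes, cut-off radial flow towards the base centre) are time-`T` maps of flows of compactly supported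
smooth fields on `ℝ⁴ = ℂ²` commuting with the rotations `(z, w) ↦ (z, u w)` of the `w`-plane, along whose
orbits the planar shadow `z` stays at distance `≥ d > 0` from every hole centre `c_l`.  This file provides,
for any such flow `θ` and any set `S` of initial points with that property on `[0, T]`, the **swept-angle
lifts** the squeeze has to carry: smooth rotation-invariant real functions `SW_l` on an open `N₀ ⊇ S` with
`u(z(θ_T x) - c_l) = e^{i SW_l(x)} u(z(x) - c_l)` on `S` (`u(v) = v/|v|`) — `ModelHandles.flow_phase`,
the argument of `…ModelHandlesCollarPhase` made generic: subdivide `[0, T]` so finely that consecutive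
shadows are closer than `d/2` (velocity bound times time step); then each ratio of consecutive offsets
from `c_l` lies in the right half-plane, where the principal argument is real-analytic, and `SW_l` is the
sum of these principal arguments (a lift by telescoping; invariant because the flow commutes with the
rotations, which do not move `z`).  Also: the coordinates `z`, `w` and the projection onto the `z`-plane
as continuous linear maps (`exists_clm_zC`, `exists_clm_wC`, `exists_clm_zProj`).

No definitions, no named facts, no `sorry`.  References: J. Milnor, *Morse Theory* (1963), §3
[Milnor1963].
-/

-- the prescribed namespace `Summit.<P>.<Sub>.…` duplicates `SmoothPoincare4` (P = Sub)
set_option linter.dupNamespace false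
set_option linter.style.longLine false

noncomputable section

open scoped Manifold ContDiff Topology
open Function Set Metric Filter
open Literature.Topology.FourManifolds Literature.Topology.FourManifolds.MMSW
open Literature.AlgebraicTopology.Homotopy.HopfFibration

namespace Summit.SmoothPoincare4.SmoothPoincare4.Theorems.DcrGap.MkFriends

namespace ModelHandles

/-! ## The complex coordinates as linear maps -/

/-- The coordinate `z` is a continuous linear map `ℝ⁴ → ℂ`. [folklore] -/
theorem exists_clm_zC : ∃ L : EuclideanSpace ℝ (Fin 4) →L[ℝ] ℂ, ∀ y, L y = zC y := by
  refine ⟨LinearMap.toContinuousLinearMap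
    { toFun := fun y => zC y
      map_add' := fun y y' => ?_
      map_smul' := fun c y => ?_ }, fun y => rfl⟩
  · apply Complex.ext <;> simp [zC]
  · apply Complex.ext <;> simp [zC]

/-- The coordinate `w` is a continuous linear map `ℝ⁴ → ℂ`. [folklore] -/
theorem exists_clm_wC : ∃ L : EuclideanSpace ℝ (Fin 4) →L[ℝ] ℂ, ∀ y, L y = wC y := by
  refine ⟨LinearMap.toContinuousLinearMap
    { toFun := fun y => wC y
      map_add' := fun y y' => ?_
      map_smul' := fun c y => ?_ }, fun y => rfl⟩
  · apply Complex.ext <;> simp [wC]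
  · apply Complex.ext <;> simp [wC]

/-- The projection `(z, w) ↦ (z, 0)` onto the `z`-plane is a continuous linear map of `ℝ⁴`. [folklore] -/
theorem exists_clm_zProj : ∃ P : EuclideanSpace ℝ (Fin 4) →L[ℝ] EuclideanSpace ℝ (Fin 4),
    ∀ y, P y = ofZW (zC y) 0 := by
  refine ⟨LinearMap.toContinuousLinearMap
    { toFun := fun y => ofZW (zC y) 0
      map_add' := fun y y' => ?_
      map_smul' := fun c y => ?_ }, fun y => rfl⟩
  · ext i
    fin_cases i <;> simp [ofZW, zC]
  · ext i
    fin_cases i <;> simp [ofZW, zC]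

/-- The shadow of a flow moves with the shadow of the field: `d/dt z(θ_t x) = z(V(θ_t x))`. [folklore] -/
theorem hasDerivAt_zC_flow {θ : ℝ × EuclideanSpace ℝ (Fin 4) → EuclideanSpace ℝ (Fin 4)}
    {V : EuclideanSpace ℝ (Fin 4) → EuclideanSpace ℝ (Fin 4)}
    (hint : ∀ x t, HasDerivAt (fun t => θ (t, x)) (V (θ (t, x))) t) (x : EuclideanSpace ℝ (Fin 4)) (t : ℝ) :
    HasDerivAt (fun t => zC (θ (t, x))) (zC (V (θ (t, x)))) t := by
  obtain ⟨L, hL⟩ := exists_clm_zC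
  have h := (L.hasFDerivAt).comp_hasDerivAt t (hint x t)
  simp only [Function.comp_def, hL] at h
  exact h

/-- The fibre coordinate of a flow moves with the fibre coordinate of the field. [folklore] -/
theorem hasDerivAt_wC_flow {θ : ℝ × EuclideanSpace ℝ (Fin 4) → EuclideanSpace ℝ (Fin 4)}
    {V : EuclideanSpace ℝ (Fin 4) → EuclideanSpace ℝ (Fin 4)}
    (hint : ∀ x t, HasDerivAt (fun t => θ (t, x)) (V (θ (t, x))) t) (x : EuclideanSpace ℝ (Fin 4)) (t : ℝ) :
    HasDerivAt (fun t => wC (θ (t, x))) (wC (V (θ (t, x)))) t := by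
  obtain ⟨L, hL⟩ := exists_clm_wC
  have h := (L.hasFDerivAt).comp_hasDerivAt t (hint x t)
  simp only [Function.comp_def, hL] at h
  exact h

/-! ## Swept angles of equivariant flows -/

/-- **Swept-angle lifts of an equivariant flow.**  Let `θ` be a smooth flow on `ℝ⁴` of a field `V`
bounded by `M`, commuting with the rotations of the `w`-plane, and `S` a set of initial points whose
shadows stay at distance `≥ d > 0` from every hole centre during `[0, T]`.  Then there are an open
`N₀ ⊇ S` and smooth rotation-invariant `SW_l : ℝ⁴ → ℝ` on `N₀` with
`u(z(θ_T x) - c_l) = e^{i SW_l(x)} u(z(x) - c_l)` for `x ∈ S` (`u(v) = v/|v|`): the sum of the principal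
arguments of the ratios of consecutive shadows along a subdivision of `[0, T]` with steps of shadow
length `≤ d/2`. [folklore] -/
theorem flow_phase (k : ℕ) {θ : ℝ × EuclideanSpace ℝ (Fin 4) → EuclideanSpace ℝ (Fin 4)}
    {V : EuclideanSpace ℝ (Fin 4) → EuclideanSpace ℝ (Fin 4)} {M T d : ℝ}
    (hθs : ContDiff ℝ ∞ θ) (h0 : ∀ x, θ (0, x) = x)
    (hint : ∀ x t, HasDerivAt (fun t => θ (t, x)) (V (θ (t, x))) t)
    (hM : ∀ y, ‖V y‖ ≤ M) (hM0 : 0 < M) (hT : 0 ≤ T) (hd : 0 < d)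
    (hcomm : ∀ u : ℂ, ‖u‖ = 1 → ∀ t x, θ (t, fibreRot (fun _ => u) x) = fibreRot (fun _ => u) (θ (t, x)))
    {S : Set (EuclideanSpace ℝ (Fin 4))}
    (hfar : ∀ x ∈ S, ∀ t, 0 ≤ t → t ≤ T → ∀ l : Fin k, d ≤ ‖zC (θ (t, x)) - holeCentre k l‖) :
    ∃ (N₀ : Set (EuclideanSpace ℝ (Fin 4))) (SW : Fin k → EuclideanSpace ℝ (Fin 4) → ℝ),
      IsOpen N₀ ∧ S ⊆ N₀ ∧ (∀ l, ContDiffOn ℝ ∞ (SW l) N₀) ∧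
      (∀ l (u : ℂ), ‖u‖ = 1 → ∀ x, SW l (fibreRot (fun _ => u) x) = SW l x) ∧
      ∀ l, ∀ x ∈ S, (zC (θ (T, x)) - holeCentre k l) / ((‖zC (θ (T, x)) - holeCentre k l‖ : ℝ) : ℂ) =
        Complex.exp ((SW l x : ℂ) * Complex.I) *
          ((zC x - holeCentre k l) / ((‖zC x - holeCentre k l‖ : ℝ) : ℂ)) := by
  -- the subdivision
  obtain ⟨n, hn⟩ := exists_nat_ge (2 * M * T / d + 1)
  have hn1 : (1 : ℝ) ≤ n := le_trans (by linarith [div_nonneg (by positivity : 0 ≤ 2 * M * T) hd.le]) hn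
  have hn0 : (n : ℝ) ≠ 0 := by positivity
  have hstep : M * (T / n) ≤ d / 2 := by
    rw [show M * (T / n) = M * T / n by ring, div_le_iff₀ (by positivity)]
    have h1 : 2 * M * T / d ≤ n - 1 := by linarith
    rw [div_le_iff₀ hd] at h1
    nlinarith
  set t : ℕ → ℝ := fun i => (i : ℝ) * (T / n) with ht
  have ht0 : t 0 = 0 := by simp [ht]
  have htn : t n = T := by simp only [ht]; field_simp
  have htmono : ∀ i, t i ≤ t (i + 1) := fun i => by
    simp only [ht]; push_cast
    nlinarith [div_nonneg hT (n.cast_nonneg : (0 : ℝ) ≤ n)]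
  have htdiff : ∀ i, t (i + 1) - t i = T / n := fun i => by
    simp only [ht]; push_cast; ring
  have htnn : ∀ i, 0 ≤ t i := fun i => by simp only [ht]; positivity
  have htle : ∀ i, i ≤ n → t i ≤ T := fun i hi => by
    simp only [ht]
    have : (i : ℝ) ≤ n := by exact_mod_cast hi
    calc (i : ℝ) * (T / n) ≤ n * (T / n) := by
          exact mul_le_mul_of_nonneg_right this (div_nonneg hT n.cast_nonneg)
      _ = T := by field_simp
  set Z : ℕ → EuclideanSpace ℝ (Fin 4) → ℂ := fun i x => zC (θ (t i, x)) with hZ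
  -- displacement along one step
  have hdisp : ∀ x i, ‖Z (i + 1) x - Z i x‖ ≤ d / 2 := by
    intro x i
    have hseg : ∀ s ∈ Icc (t i) (t (i + 1)), HasDerivWithinAt (fun s => θ (s, x)) (V (θ (s, x)))
        (Icc (t i) (t (i + 1))) s := fun s _ => (hint x s).hasDerivWithinAt
    have h := norm_image_sub_le_of_norm_deriv_le_segment' hseg (fun s _ => hM _) (t (i + 1))
      ⟨htmono i, le_rfl⟩
    rw [htdiff] at h
    calc ‖Z (i + 1) x - Z i x‖ ≤ ‖θ (t (i + 1), x) - θ (t i, x)‖ := norm_zC_sub_le _ _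
      _ ≤ M * (T / n) := h
      _ ≤ d / 2 := hstep
  -- the good set
  set N₀ : Set (EuclideanSpace ℝ (Fin 4)) := {x | ∀ l : Fin k, ∀ i ∈ Finset.range n,
    Z i x - holeCentre k l ≠ 0 ∧ 0 < ((Z (i + 1) x - holeCentre k l) / (Z i x - holeCentre k l)).re}
    with hN₀
  have hZs : ∀ i, ContDiff ℝ ∞ (Z i) := fun i =>
    contDiff_zC.comp (hθs.comp (contDiff_const.prodMk contDiff_id))
  have hN₀o : IsOpen N₀ := by
    have : N₀ = ⋂ l : Fin k, ⋂ i ∈ Finset.range n, ({x | Z i x - holeCentre k l ≠ 0} ∩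
        (fun x => (Z (i + 1) x - holeCentre k l) / (Z i x - holeCentre k l)) ⁻¹' {q | 0 < q.re}) := by
      ext x; simp only [hN₀, mem_setOf_eq, mem_iInter, mem_inter_iff, mem_preimage]
    rw [this]
    refine isOpen_iInter_of_finite fun l => isOpen_biInter_finset fun i _ => ?_
    have hO : IsOpen {x : EuclideanSpace ℝ (Fin 4) | Z i x - holeCentre k l ≠ 0} :=
      isOpen_ne_fun ((hZs i).continuous.sub continuous_const) continuous_const
    refine ContinuousOn.isOpen_inter_preimage ?_ hO (isOpen_lt continuous_const Complex.continuous_re)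
    exact ((hZs (i + 1)).continuous.sub continuous_const).continuousOn.div
      ((hZs i).continuous.sub continuous_const).continuousOn fun x hx => hx
  -- `S ⊆ N₀`
  have hfar' : ∀ x ∈ S, ∀ i, i ≤ n → ∀ l : Fin k, d ≤ ‖Z i x - holeCentre k l‖ :=
    fun x hx i hi l => hfar x hx (t i) (htnn i) (htle i hi) l
  have hDN : S ⊆ N₀ := by
    intro x hx l i hi
    have hi' : i + 1 ≤ n := Nat.succ_le_of_lt (Finset.mem_range.1 hi)
    have hi'' : i ≤ n := Nat.le_of_succ_le hi'
    have hz : Z i x - holeCentre k l ≠ 0 := fun h => by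
      have := hfar' x hx i hi'' l; rw [h, norm_zero] at this; linarith
    refine ⟨hz, ?_⟩
    have hq : ‖(Z (i + 1) x - Z i x) / (Z i x - holeCentre k l)‖ < 1 := by
      rw [norm_div, div_lt_one (norm_pos_iff.2 hz)]
      linarith [hdisp x i, hfar' x hx i hi'' l]
    have heq : (Z (i + 1) x - holeCentre k l) / (Z i x - holeCentre k l) =
        1 + (Z (i + 1) x - Z i x) / (Z i x - holeCentre k l) := by
      field_simp; ring
    rw [heq, Complex.add_re, Complex.one_re]
    have := Complex.abs_re_le_norm ((Z (i + 1) x - Z i x) / (Z i x - holeCentre k l))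
    linarith [neg_abs_le ((Z (i + 1) x - Z i x) / (Z i x - holeCentre k l)).re]
  -- the swept angles
  set SW : Fin k → EuclideanSpace ℝ (Fin 4) → ℝ := fun l x =>
    ∑ i ∈ Finset.range n, Complex.arg ((Z (i + 1) x - holeCentre k l) / (Z i x - holeCentre k l))
    with hSW
  have hSWs : ∀ l, ContDiffOn ℝ ∞ (SW l) N₀ := by
    intro l x hx
    refine ContDiffWithinAt.mono_of_mem_nhdsWithin (s := univ) ?_ (by simp)
    rw [contDiffWithinAt_univ]
    refine ContDiffAt.sum fun i hi => ?_
    obtain ⟨hz, hre⟩ := hx l i hi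
    have hR : ContDiffAt ℝ ∞ (fun x => (Z (i + 1) x - holeCentre k l) / (Z i x - holeCentre k l)) x := by
      simp only [div_eq_mul_inv]
      exact (((hZs (i + 1)).sub contDiff_const).contDiffAt).mul
        ((((hZs i).sub contDiff_const).contDiffAt).inv hz)
    exact (contDiffAt_arg (Or.inl hre)).comp x hR
  -- invariance
  have hZrot : ∀ (u : ℂ), ‖u‖ = 1 → ∀ i x, Z i (fibreRot (fun _ => u) x) = Z i x := by
    intro u hu i x
    simp only [hZ, hcomm u hu, zC_fibreRot]
  have hSWrot : ∀ l (u : ℂ), ‖u‖ = 1 → ∀ x, SW l (fibreRot (fun _ => u) x) = SW l x := by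
    intro l u hu x
    simp only [hSW, hZrot u hu]
  -- the telescoping identity
  have htel : ∀ l, ∀ x ∈ S, ∀ i, i ≤ n →
      (Z i x - holeCentre k l) / ((‖Z i x - holeCentre k l‖ : ℝ) : ℂ) =
        Complex.exp (((∑ i' ∈ Finset.range i, Complex.arg ((Z (i' + 1) x - holeCentre k l) /
          (Z i' x - holeCentre k l)) : ℝ) : ℂ) * Complex.I) *
          ((Z 0 x - holeCentre k l) / ((‖Z 0 x - holeCentre k l‖ : ℝ) : ℂ)) := by
    intro l x hx i hi
    induction i with
    | zero => simp
    | succ i ih =>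
      have hz : Z i x - holeCentre k l ≠ 0 := fun h => by
        have := hfar' x hx i (Nat.le_of_succ_le hi) l; rw [h, norm_zero] at this; linarith
      have hz' : Z (i + 1) x - holeCentre k l ≠ 0 := fun h => by
        have := hfar' x hx (i + 1) hi l; rw [h, norm_zero] at this; linarith
      have hRne : (Z (i + 1) x - holeCentre k l) / (Z i x - holeCentre k l) ≠ 0 := div_ne_zero hz' hz
      have hfac : Z (i + 1) x - holeCentre k l =
          (Z (i + 1) x - holeCentre k l) / (Z i x - holeCentre k l) * (Z i x - holeCentre k l) := by
        rw [div_mul_cancel₀ _ hz]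
      rw [hfac, unit_mul, ih (Nat.le_of_succ_le hi), unit_eq_exp_arg hRne, Finset.sum_range_succ]
      push_cast
      rw [add_mul, Complex.exp_add]
      ring
  refine ⟨N₀, SW, hN₀o, hDN, hSWs, hSWrot, fun l x hx => ?_⟩
  have h := htel l x hx n le_rfl
  have hZn : Z n x = zC (θ (T, x)) := by simp only [hZ, htn]
  have hZ0 : Z 0 x = zC x := by simp only [hZ, ht0, h0]
  rw [hZn, hZ0] at h
  exact h

end ModelHandles

/-- **Registered piece `helper_handlebodyChart_modelHandles_flowPhase` of the model lemma M3 (swept angles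
of equivariant flows)**: for a smooth flow on `ℝ⁴` of a bounded field commuting with the rotations of the
`w`-plane and a set of initial points whose shadows stay at distance `≥ d > 0` from the hole centres during
`[0, T]`, the time-`T` map carries smooth rotation-invariant lifts of the angles swept about the hole centres
(`ModelHandles.flow_phase`). [folklore] -/
theorem helper_handlebodyChart_modelHandles_flowPhase : ∀ (k : ℕ) (θ : ℝ × EuclideanSpace ℝ (Fin 4) → EuclideanSpace ℝ (Fin 4)) (V : EuclideanSpace ℝ (Fin 4) → EuclideanSpace ℝ (Fin 4)) (M T d : ℝ) (S : Set (EuclideanSpace ℝ (Fin 4))), ContDiff ℝ ((⊤ : ℕ∞) : WithTop ℕ∞) θ → (∀ x, θ (0, x) = x) → (∀ x t, HasDerivAt (fun t => θ (t, x)) (V (θ (t, x))) t) → (∀ y, ‖V y‖ ≤ M) → 0 < M → 0 ≤ T → 0 < d → (∀ u : ℂ, ‖u‖ = 1 → ∀ t x, θ (t, Literature.Topology.FourManifolds.MMSW.fibreRot (fun _ => u) x) = Literature.Topology.FourManifolds.MMSW.fibreRot (fun _ => u) (θ (t, x))) → (∀ x ∈ S, ∀ t : ℝ, 0 ≤ t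 → t ≤ T → ∀ l : Fin k, d ≤ ‖Literature.AlgebraicTopology.Homotopy.HopfFibration.zC (θ (t, x)) - Literature.Topology.FourManifolds.MMSW.holeCentre k l‖) → ∃ (N₀ : Set (EuclideanSpace ℝ (Fin 4))) (SW : Fin k → EuclideanSpace ℝ (Fin 4) → ℝ), IsOpen N₀ ∧ S ⊆ N₀ ∧ (∀ l, ContDiffOn ℝ ((⊤ : ℕ∞) : WithTop ℕ∞) (SW l) N₀) ∧ (∀ l (u : ℂ), ‖u‖ = 1 → ∀ x, SW l (Literature.Topology.FourManifolds.MMSW.fibreRot (fun _ => u) x) = SW l x) ∧ ∀ l, ∀ x ∈ S, (Literature.AlgebraicTopology.Homotopy.HopfFibration.zC (θ (T, x)) - Literature.Topology.FourManifolds.MMSW.holeCentre k l) / ((‖Literature.AlgebraicTopology.Homotopy.HopfFibration.zC (θ (T, x)) - Literature.Topology.FourManifolds.MMSW.holeCentre k l‖ : ℝ) : ℂ) = Complex.exp ((SW l x : ℂ) * Complex.I) * ((Literature.AlgebraicTopology.Homotopy.HopfFibration.zC x - Literature.Topology.FourManifolds.MMSW.holeCentre k l) / ((‖Literature.AlgebraicTopology.Homotopy.HopfFibration.zC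 x - Literature.Topology.FourManifolds.MMSW.holeCentre k l‖ : ℝ) : ℂ)) :=
  fun k _ _ _ _ _ _ hθs h0 hint hM hM0 hT hd hcomm hfar => ModelHandles.flow_phase k hθs h0 hint hM hM0 hT hd hcomm hfar

end Summit.SmoothPoincare4.SmoothPoincare4.Theorems.DcrGap.MkFriends

end
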